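import Literature.IUT.HodgeTheaters.InitialThetaDataRemarks
import Mathlib.GroupTheory.Index
import HarnessLib

/-!
# [IUTchI] Remark 3.1.2 (i) as typed (`InitialThetaData.PiXKCharacteristic`) — CONDITIONAL INSTANCE FORMS
# (FACT-LIST row F-0266)

S. Mochizuki, *Inter-universal Teichmüller theory I*, §3, Remark 3.1.2 (i), kurims p. 64 (May 2020
manuscript): "the open subgroup `Π_{X_K} ⊆ Π_{C_K}` may be constructed group-theoretically from the
topological group `Π_{C_K}`" [cite: Mochizuki2012, IUTchI Rmk 3.1.2 (i) p.64].  Typed (abc-iut-L5-t2,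
`InitialThetaDataRemarks.lean`) as the predicate `D.PiXKCharacteristic` on an initial Θ-datum
`D : InitialThetaData F K F̄ E l P`: every bicontinuous group automorphism of `Π_{C_K}` carries `Π_{X_K}`
onto itself.  PROOF-ONLY companion (theorems only; no `def`).

Bookkeeping context (abc-iut cell, block F, row INST59C of the LF kernel census): the universal closure of
F-0266 is REFUTED in tree at every inhabited parameter tuple (`InitialThetaDataPiXKCharacteristicSchema.lean`,
abc-iut-w4-d075: re-gluing the free `π₁`-interface slot `geom` along a profinite model whose
`ℤ/2`-coordinate swap moves `Π_{X_K}`; `forall_piXKCharacteristic_iff_isEmpty`), and no theorem of the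
tree concludes in the declaration (its content at the genuine datum is [AbsTopI] Lemma 4.5 — cuspidal
decomposition groups are group-theoretic — which the interface does not carry; no closed initial Θ-datum
is constructed in the tree, GAP row G-L5t7g4-1).  This file records the elementary SUFFICIENT CRITERIA
under which the typed predicate holds, as CONDITIONAL INSTANCE theorems whose conclusion head is
LITERALLY the FACT-LIST declaration:

* `piXKCharacteristic_of_forall_index_eq` — if `Π_{X_K}` is the ONLY subgroup of `Π_{C_K}` of its index
  (e.g. the unique subgroup of index `2`), then it is carried onto itself by every group automorphism of
  `Π_{C_K}` (indices are preserved), in particular by the bicontinuous ones;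
* `piXKCharacteristic_of_forall_map_eq` — more generally, if `Π_{X_K}` is fixed by every ABSTRACT group
  automorphism (a characteristic subgroup in the algebraic sense), the topological predicate follows;
* `piXKCharacteristic_of_characteristic` — the same from Mathlib's `Subgroup.Characteristic`.

These criteria are NOT print's argument (which reads `Π_{X_K}` off the cuspidal decomposition groups) and
say nothing about whether the genuine `Π_{X_K} ⊆ Π_{C_K}` satisfies them; they delimit the class of
interface values the closure refuter spares.  HONEST FRAMING: elementary group theory about OUR typing;
nothing of [IUTchI] is asserted or denied; refuted-closure ≠ refuted-in-print; typed ≠ proved; nothing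
here bears on [IUTchIII] Cor. 3.12; no side taken.
-/

namespace Literature.IUT.HodgeTheaters

universe u v w

section ForData

variable {F : Type u} {K : Type v} {Fbar : Type w} [Field F] [NumberField F] [Field K]
  [NumberField K] [Algebra F K] [Field Fbar] [Algebra F Fbar] [Algebra K Fbar]
  {E : WeierstrassCurve F} [E.IsElliptic] {l : ℕ} {P : BadPlacePredicates K}
  (D : InitialThetaData F K Fbar E l P)

namespace InitialThetaData

/-- **F-0266, CONDITIONAL INSTANCE (algebraically characteristic ⇒ topologically characteristic).**
If `Π_{X_K} ⊆ Π_{C_K}` is carried onto itself by EVERY group automorphism of `Π_{C_K}`, then in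
particular by the bicontinuous ones: the typed [IUTchI] Rmk 3.1.2 (i) holds for `D`.
[cite: Mochizuki2012, IUTchI Rmk 3.1.2 (i) p.64] -/
theorem piXKCharacteristic_of_forall_map_eq
    (h : ∀ φ : D.PiCK ≃* D.PiCK, (D.PiXK.subgroupOf D.PiCK).map φ.toMonoidHom = D.PiXK.subgroupOf D.PiCK) :
    Literature.IUT.HodgeTheaters.InitialThetaData.PiXKCharacteristic D :=
  fun φ _ _ => h φ

/-- **F-0266, CONDITIONAL INSTANCE via Mathlib's `Subgroup.Characteristic`.**  If `Π_{X_K}` is a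
characteristic subgroup of `Π_{C_K}` in the algebraic sense (fixed under `comap` by every group
automorphism), the typed [IUTchI] Rmk 3.1.2 (i) holds for `D`. [cite: Mochizuki2012, IUTchI Rmk 3.1.2 (i) p.64] -/
theorem piXKCharacteristic_of_characteristic (h : (D.PiXK.subgroupOf D.PiCK).Characteristic) :
    Literature.IUT.HodgeTheaters.InitialThetaData.PiXKCharacteristic D := by
  refine piXKCharacteristic_of_forall_map_eq D fun φ => ?_
  have hc := (Subgroup.characteristic_iff_map_eq.mp h) φ
  exact hc

/-- **F-0266, CONDITIONAL INSTANCE (unique subgroup of its index).**  If `Π_{X_K}` is the ONLY subgroup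
of `Π_{C_K}` of its index — for instance the unique (open) subgroup of index `2` — then every group
automorphism `φ` of `Π_{C_K}` carries it onto itself, since `φ(Π_{X_K})` has the same index
(`Subgroup.index_map_of_bijective`); so the typed [IUTchI] Rmk 3.1.2 (i) holds for `D`.  Elementary
sufficient criterion, not print's cuspidal-decomposition-group argument.
[cite: Mochizuki2012, IUTchI Rmk 3.1.2 (i) p.64] -/
theorem piXKCharacteristic_of_forall_index_eq
    (huniq : ∀ H : Subgroup D.PiCK,
      H.index = (D.PiXK.subgroupOf D.PiCK).index → H = D.PiXK.subgroupOf D.PiCK) :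
    Literature.IUT.HodgeTheaters.InitialThetaData.PiXKCharacteristic D :=
  piXKCharacteristic_of_forall_map_eq D fun φ =>
    huniq _ (Subgroup.index_map_of_bijective (f := φ.toMonoidHom) φ.bijective _)

end InitialThetaData

end ForData

end Literature.IUT.HodgeTheaters
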